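/-
Copyright (c) 2026 the pub-hodgecm-mathlib formalisation cell (harness21).  Prover seat hodgecm-mathlib-LH4-p10 (g2), req620 Track A «(D-RAM) FOUR-FRAME» squad
(MS ROAD A, Stage B lead; DEFS LEAF for the Stage B assembly B10 of SPEC `F0/P3c/LH4/LH4-p10/g2/SPEC-StageB.v1.LH4p10g2.md`).  2026-09-04.
-/
import Summits.HodgeConjecture.HodgeConjecture.Theorems.F0P3cDyRamDiagonalTorusDefs   -- ★ p855572: `normalisedStableLattices`, `IsDualisableLattice`, `stabiliserWeight`
import HarnessLib

/-!
# Crux `H413`, MS ROAD A, STAGE B — DEFS LEAF «AXIS VECTORS AND STRATA» (two definitions + `Iff.rfl` ties)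

Cell `hodgecm-mathlib` (D-0151), FLOOR 0, crux item H413 = `stmt-HodgeConjecture-24833`.  DEFINITIONS ONLY (review lane), no theorem content beyond `Iff.rfl`∕`rfl` ties.
The Stage B count `N₀ = Σ_{M ∈ 𝓛₀(T), M dualisable} 1∕[U_F : S_F(M)] = [k]_q` (LH4-p10 (g2) MEMO v2, B10 skeleton `B10-StableCountTypeZero.SKELETON.v1`) is assembled by
PARTITIONING the dualisable normalised `T`-stable lattices by their AXIS VECTOR `a(M) = (a₀, a₁, a₂)`, `M ∩ K·eᵢ = 𝔭^{aᵢ}eᵢ` (= the tree distances to the three splitting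
sub-buildings; LH4-p11 DATUM §10).  This leaf names the two objects every Stage B brick (B3 strata table, B4 split strata, B5∕B6 glued strata, B7 core-hanging strata) states
its head about, so that the heads are byte-compatible with the assembly.
* `HasAxis ϖ M a` — `∀ i t, t·eᵢ ∈ M ↔ |t| ≤ |ϖ|^{aᵢ}`.
* `stratum σ ϖ T a` — `{M ∈ normalisedStableLattices T | IsDualisableLattice σ ϖ M ∧ HasAxis ϖ M a}`.
HONEST LABEL.  Count-neutral; `HC_CM` is proved only modulo the 7 printed citations (2 remaining named inputs: hLiu418 = `stmt-HodgeConjecture-24832`, h413 = `stmt-HodgeConjecture-24833`) until rung 0 closes.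

## References
* [Kottwitz1986BaseChangeUnits] R. Kottwitz, *Base change for unit elements of Hecke algebras*, Compositio Math. 60 (1986), §1 pp. 240–241 (fixed-lattice counting by position).
* [Serre1980Trees] J.-P. Serre, *Trees*, Springer (1980), Ch. II §1.1 (lattices and their coordinate axes).
-/

set_option autoImplicit false

noncomputable section

namespace Summit.HodgeConjecture.HodgeConjecture.Cruxes.H413.F0P3cDyRamDiagonalStrataDefs

open Literature.NumberTheory.Automorphic Literature.NumberTheory.Automorphic.HermitianLattice
open Literature.NumberTheory.Automorphic.UnitaryLatticeTree
open Summit.HodgeConjecture.HodgeConjecture.Cruxes.H413.F0P3cDyRamDiagonalTorusDefs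
open scoped Valued WithZero Matrix MatrixGroups

variable {K : Type*} [Field K] [Valued K ℤᵐ⁰] {N : ℕ}

/-- **AXIS VECTOR**: `M` has axis exponents `a` when `M ∩ K·eᵢ = 𝔭^{aᵢ}·eᵢ` for every coordinate `i`, i.e. `t·eᵢ ∈ M ↔ |t| ≤ |ϖ|^{aᵢ}` (LH4-p10 MEMO v2 §1: for the HNF
lattice `(1 0 0; x ϖ^b 0; y z ϖ^c)·𝒪³` one has `a₂ = c`, `a₁ = b + max(0, c − v z)`, `a₀ = max(b, c − v(y − xz∕ϖ^b))`; ★ p855755 reads them off). [cite: Serre1980Trees, Ch. II §1.1] -/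
def HasAxis (ϖ : K) (M : Submodule 𝒪[K] (Fin N → K)) (a : Fin N → ℕ) : Prop :=
  ∀ (i : Fin N) (t : K), (Pi.single i t : Fin N → K) ∈ M ↔ Valued.v t ≤ Valued.v ϖ ^ (a i)

/-- **THE STRATUM OF AXIS VECTOR `a`**: the dualisable normalised `T`-stable lattices with `M ∩ K·eᵢ = 𝔭^{aᵢ}eᵢ` — the cells of the Stage B partition (core `a = 0`; on-branch
`(0,s,s)`; glued `(r, r+s, r+s)`; core-hanging `(r,r,r)`; and coordinate permutations). [cite: Kottwitz1986BaseChangeUnits, §1 pp. 240–241] -/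
def stratum (σ : K →+* K) (ϖ : K) (T : GL (Fin N) K) (a : Fin N → ℕ) : Set (Submodule 𝒪[K] (Fin N → K)) :=
  {M | M ∈ normalisedStableLattices T ∧ IsDualisableLattice σ ϖ M ∧ HasAxis ϖ M a}

/-- Membership in `HasAxis`, `Iff.rfl`. [cite: Serre1980Trees, Ch. II §1.1] -/
theorem hasAxis_iff (ϖ : K) (M : Submodule 𝒪[K] (Fin N → K)) (a : Fin N → ℕ) :
    HasAxis ϖ M a ↔ ∀ (i : Fin N) (t : K), (Pi.single i t : Fin N → K) ∈ M ↔ Valued.v t ≤ Valued.v ϖ ^ (a i) := Iff.rfl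

/-- Membership in a stratum, `Iff.rfl`. [cite: Kottwitz1986BaseChangeUnits, §1 pp. 240–241] -/
theorem mem_stratum_iff (σ : K →+* K) (ϖ : K) (T : GL (Fin N) K) (a : Fin N → ℕ) (M : Submodule 𝒪[K] (Fin N → K)) :
    M ∈ stratum σ ϖ T a ↔ M ∈ normalisedStableLattices T ∧ IsDualisableLattice σ ϖ M ∧ HasAxis ϖ M a := Iff.rfl

/-- A stratum is contained in the dualisable part of `𝓛₀(T)`. [cite: Kottwitz1986BaseChangeUnits, §1 pp. 240–241] -/
theorem stratum_subset (σ : K →+* K) (ϖ : K) (T : GL (Fin N) K) (a : Fin N → ℕ) :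
    stratum σ ϖ T a ⊆ {M | M ∈ normalisedStableLattices T ∧ IsDualisableLattice σ ϖ M} := fun _ h => ⟨h.1, h.2.1⟩

/-! ## ED. 2 (append-only; LH4-p11 (g2) on LH4-p13 (g2)'s 00:20:59Z naming question, skeleton `B10-StableCountTypeTwo.SKELETON.v1` 08e5e6e2d02c47d3 VERBATIM):
the TYPE-2 twins of the two objects — `IsTypeTwoPolarisable` and `stratumTwo` — so that B3₂∕B4₂∕B5₂∕B7₂, the B9-0₂ uniqueness sockets, (O2c)₂ and B10₂ share one name -/

/-- **TYPE-2 POLARISABLE**: `M` is a type-`2` vertex lattice of SOME non-degenerate `σ`-fixed diagonal form `diag(D)` (LH4-p10 MEMO v2.1 §T2.4; the type-2 twin of ★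
`IsDualisableLattice`, which is the same sentence at type `0`).  The (O2c) orbit count at `tv = 2` sums `stabiliserWeight` over exactly these members of `𝓛₀(T)`.
[cite: Kottwitz1986BaseChangeUnits, §1 pp. 240–241] -/
def IsTypeTwoPolarisable (σ : K →+* K) (ϖ : K) (M : Submodule 𝒪[K] (Fin N → K)) : Prop :=
  ∃ D : Fin N → K, (∀ i, σ (D i) = D i ∧ D i ≠ 0) ∧ IsVertexLattice σ ϖ (Matrix.diagonal D) 2 M

/-- **THE TYPE-2 STRATUM OF AXIS VECTOR `a`**: the type-2-polarisable normalised `T`-stable lattices with `M ∩ K·eᵢ = 𝔭^{aᵢ}eᵢ` — the cells of the B10₂ partition (on-branch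
`(0,s,s)` with `s` odd; glued `(r, r+s, r+s)` with `r` odd, `s` even; core-hanging `(r,r,r)` with `r` odd; coordinate permutations; no core). [cite: Kottwitz1986BaseChangeUnits, §1 pp. 240–241] -/
def stratumTwo (σ : K →+* K) (ϖ : K) (T : GL (Fin N) K) (a : Fin N → ℕ) : Set (Submodule 𝒪[K] (Fin N → K)) :=
  {M | M ∈ normalisedStableLattices T ∧ IsTypeTwoPolarisable σ ϖ M ∧ HasAxis ϖ M a}

/-- Unfolding `IsTypeTwoPolarisable`, `Iff.rfl`. [cite: Kottwitz1986BaseChangeUnits, §1 pp. 240–241] -/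
theorem isTypeTwoPolarisable_iff (σ : K →+* K) (ϖ : K) (M : Submodule 𝒪[K] (Fin N → K)) :
    IsTypeTwoPolarisable σ ϖ M ↔ ∃ D : Fin N → K, (∀ i, σ (D i) = D i ∧ D i ≠ 0) ∧ IsVertexLattice σ ϖ (Matrix.diagonal D) 2 M := Iff.rfl

/-- Membership in a type-2 stratum, `Iff.rfl`. [cite: Kottwitz1986BaseChangeUnits, §1 pp. 240–241] -/
theorem mem_stratumTwo_iff (σ : K →+* K) (ϖ : K) (T : GL (Fin N) K) (a : Fin N → ℕ) (M : Submodule 𝒪[K] (Fin N → K)) :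
    M ∈ stratumTwo σ ϖ T a ↔ M ∈ normalisedStableLattices T ∧ IsTypeTwoPolarisable σ ϖ M ∧ HasAxis ϖ M a := Iff.rfl

/-- A type-2 stratum is contained in the type-2-polarisable part of `𝓛₀(T)` (the index set of B10₂ ∕ (O2c)₂). [cite: Kottwitz1986BaseChangeUnits, §1 pp. 240–241] -/
theorem stratumTwo_subset (σ : K →+* K) (ϖ : K) (T : GL (Fin N) K) (a : Fin N → ℕ) :
    stratumTwo σ ϖ T a ⊆ {M | M ∈ normalisedStableLattices T ∧ IsTypeTwoPolarisable σ ϖ M} := fun _ h => ⟨h.1, h.2.1⟩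

/-- The type-2-polarisable part of `𝓛₀(T)` written with the predicate unfolded — the right-hand index set of (O2c) `…DiagonalOrbitCount.sum_ncard_fixed_vertices_eq_eight_mul_finsum_stabiliserWeight`
at `tv = 2` IS `{M ∈ 𝓛₀(T) | IsTypeTwoPolarisable σ ϖ M}` (`rfl`). [cite: Kottwitz1986BaseChangeUnits, §1 pp. 240–241] -/
theorem setOf_mem_and_isTypeTwoPolarisable_eq (σ : K →+* K) (ϖ : K) (T : GL (Fin N) K) :
    {M : Submodule 𝒪[K] (Fin N → K) | M ∈ normalisedStableLattices T ∧
        ∃ D : Fin N → K, (∀ i, σ (D i) = D i ∧ D i ≠ 0) ∧ IsVertexLattice σ ϖ (Matrix.diagonal D) 2 M} =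
      {M | M ∈ normalisedStableLattices T ∧ IsTypeTwoPolarisable σ ϖ M} := rfl

/-! ## ED. 3 (append-only; LH4-p11 (g2) RULING 2026-09-04T00:53Z on LH4-p09 (g2)'s flag «n₂ = q on glued type-2 strata with ρ even», dealer WORD #21): THE POLARISATION
COUNT `n_tv(M) = #(Δ_tv(M) ∕ S_F(M))` — the multiplicity on which the type-2 half of (MS) is RE-KEYED (Stage A₂: `Σ_e C_tv(e) = 8·Σ_{M ∈ 𝓛₀(T)} n_tv(M)·w(M)`; Stage B₂:
`Σ_{M ∈ 𝓛₀(T)} n₂(M)·w(M) = [k]_q` stratum by stratum) -/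

/-- **THE POLARISATION COSETS `Δ_tv(M) ∕ S_F(M)`**: the set of `S_F(M)`-cosets `D·S_F(M)` of the non-degenerate `σ`-fixed diagonal forms `diag(D)` of which `M` is a type-`tv` vertex
lattice (`Δ_tv(M)` is a union of such cosets: a stabilising fixed unit diagonal moves the form, ★ `F0P3cDyRamDiagonalPolarisationCoset` §1).  (LH4-p09 (g2): on the glued type-2
strata with `ρ` even these are `q` cosets, elsewhere one; LH4-p10 oracle `cnt`.) [cite: Kottwitz1986BaseChangeUnits, §1 pp. 240–241] -/
def polarisationCosets (σ : K →+* K) (ϖ : K) (tv : ℕ) (M : Submodule 𝒪[K] (Fin N → K)) : Set (Set (Fin N → K)) :=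
  {C | ∃ D : Fin N → K, ((∀ i, σ (D i) = D i ∧ D i ≠ 0) ∧ IsVertexLattice σ ϖ (Matrix.diagonal D) tv M) ∧
    C = {D' : Fin N → K | ∃ u ∈ fixedUnitStabilizer σ M, ∀ i, D' i = D i * ((u i : Kˣ) : K)}}

/-- **THE POLARISATION COUNT `n_tv(M) := #(Δ_tv(M) ∕ S_F(M))`** (`Set.ncard` of ★ `polarisationCosets`; `0` when `M` has no type-`tv` polarisation or infinitely many cosets).  The
MULTIPLICITY of the re-keyed type-2 half of (MS): Stage A₂ `Σ_e C_tv(e) = 8·Σᶠ_{M₀ ∈ 𝓛₀(T)} n_tv(M₀)·stabiliserWeight σ M₀`, Stage B₂ `Σᶠ_{M ∈ stratumTwo σ ϖ T a} n₂(M)·stabiliserWeight σ M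
= ‹the MEMO v2.1 table›` (LH4-p09 (g2) 2026-09-04T00:42:58Z; = LH4-p10's oracle `cnt ∈ {0, 1, q}`). [cite: Kottwitz1986BaseChangeUnits, §1 pp. 240–241] -/
def polarisationCount (σ : K →+* K) (ϖ : K) (tv : ℕ) (M : Submodule 𝒪[K] (Fin N → K)) : ℕ :=
  (polarisationCosets σ ϖ tv M).ncard

/-- Membership in `polarisationCosets`, `Iff.rfl`. [cite: Kottwitz1986BaseChangeUnits, §1 pp. 240–241] -/
theorem mem_polarisationCosets_iff (σ : K →+* K) (ϖ : K) (tv : ℕ) (M : Submodule 𝒪[K] (Fin N → K)) (C : Set (Fin N → K)) :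
    C ∈ polarisationCosets σ ϖ tv M ↔ ∃ D : Fin N → K, ((∀ i, σ (D i) = D i ∧ D i ≠ 0) ∧ IsVertexLattice σ ϖ (Matrix.diagonal D) tv M) ∧
      C = {D' : Fin N → K | ∃ u ∈ fixedUnitStabilizer σ M, ∀ i, D' i = D i * ((u i : Kˣ) : K)} := Iff.rfl

/-- Unfolding `polarisationCount`, `rfl`. [cite: Kottwitz1986BaseChangeUnits, §1 pp. 240–241] -/
theorem polarisationCount_eq (σ : K →+* K) (ϖ : K) (tv : ℕ) (M : Submodule 𝒪[K] (Fin N → K)) :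
    polarisationCount σ ϖ tv M = (polarisationCosets σ ϖ tv M).ncard := rfl

/-- No type-`tv` polarisation ⟹ no cosets ⟹ `polarisationCount = 0` (so the re-keyed sums may run over all of `𝓛₀(T)`). [cite: Kottwitz1986BaseChangeUnits, §1 pp. 240–241] -/
theorem polarisationCount_eq_zero_of_not_exists (σ : K →+* K) (ϖ : K) (tv : ℕ) (M : Submodule 𝒪[K] (Fin N → K))
    (h : ¬ ∃ D : Fin N → K, (∀ i, σ (D i) = D i ∧ D i ≠ 0) ∧ IsVertexLattice σ ϖ (Matrix.diagonal D) tv M) :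
    polarisationCount σ ϖ tv M = 0 := by
  have he : polarisationCosets σ ϖ tv M = ∅ :=
    Set.eq_empty_of_forall_notMem fun C ⟨D, hD, _⟩ => h ⟨D, hD.1, hD.2⟩
  rw [polarisationCount, he, Set.ncard_empty]

/-- At `tv = 2`: a lattice that is NOT type-2-polarisable has `polarisationCount σ ϖ 2 M = 0`. [cite: Kottwitz1986BaseChangeUnits, §1 pp. 240–241] -/
theorem polarisationCount_two_eq_zero_of_not_isTypeTwoPolarisable (σ : K →+* K) (ϖ : K) (M : Submodule 𝒪[K] (Fin N → K))
    (h : ¬ IsTypeTwoPolarisable σ ϖ M) : polarisationCount σ ϖ 2 M = 0 :=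
  polarisationCount_eq_zero_of_not_exists σ ϖ 2 M h

end Summit.HodgeConjecture.HodgeConjecture.Cruxes.H413.F0P3cDyRamDiagonalStrataDefs

end
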